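import Literature.Probability.LatticeModels.RCRealize
import Literature.Probability.LatticeModels.PSPolymerActivity
import HarnessLib

/-!
# Random-cluster contours, X: translation invariance

Topic `Literature/Probability/LatticeModels`. Lattice translations act on everything built in
`RCContours`–`RCRealize`, as required by the translation-invariant Pirogov–Sinai engine
(`ContourSetup.Shift` of `PSPolymerActivity`; Friedli–Velenik 2017, §7.4.2: the classes of contours and
their weights are translation invariant):

* §1 translating sites (`x ↦ x + v`), edges (`shE`), edge sets (`shiftE`) and finite sets (`shiftSet` of
  `PolymerPressure`): balls, neighbours, `nnEdges`, `coBall`, `ballEdges`, `core`, `inner1`, `freeEdges`,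
  the `★`-boundaries, `★`-chains and `★`-connectedness, the exterior (`add_mem_starExt_iff`, `d ≥ 2`), the
  hull, the interior and its components all commute with translations;
* §2 the number of classes of a relation on a finite set is invariant under an injective relabelling
  respecting the relation (`ccount_image`);
* §3 configurations: openness, goodness, badness, the thick bad set, its components, the supports and the
  extracted contours commute with translations (`contourAt_shift`), so translates of well-formed contours
  are well-formed (`WF.shift`); the translate `Contour.shift v c` of a contour has the same intrinsic
  openness, labels, type, energy `e(γ)` and cluster exponent `cwt(γ)` (`energy_shift`, `cwt_shift`);
* §4 the energy and the cluster functional of a configuration of a volume, hence the partition functions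
  `Zrc t q σ V`, are translation invariant (`Zrc_shift`), and the translation action `rcShift hd` on the
  contour setup `rcSetup d` of well-formed random-cluster contours.

Everything is proved; no named facts.

## References

* S. Friedli, Y. Velenik, *Statistical Mechanics of Lattice Systems*, CUP 2017, §7.4.2 (translation
  invariance of `𝒞^#` and of the weights `w^#`). [FriedliVelenik2017]
* G. Grimmett, *The Random-Cluster Model*, Springer 2006, §4.3 (automorphism invariance). [Grimmett2006]
-/

noncomputable section

open Finset Relation

namespace Literature.Probability.LatticeModels

namespace RCC

open ContourSetup ClassCount

variable {d : ℕ}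

/-! ### 1. Translating sites, edges and finite sets -/

section Geometry

variable (v : Site d)

/-- Translation of an edge by `v`. [folklore] -/
def shE (v : Site d) (e : Sym2 (Site d)) : Sym2 (Site d) := Sym2.map (· + v) e

/-- Translation of an edge set by `v`. [folklore] -/
def shiftE (v : Site d) (F : Finset (Sym2 (Site d))) : Finset (Sym2 (Site d)) := F.image (shE v)

/-- `shE` on a pair. [folklore] -/
@[simp] theorem shE_mk (x y : Site d) : shE v s(x, y) = s(x + v, y + v) := rfl

/-- Translations of edges compose. [folklore] -/
theorem shE_shE (u v : Site d) (e : Sym2 (Site d)) : shE u (shE v e) = shE (v + u) e := by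
  induction e using Sym2.ind with
  | h x y => simp [add_assoc]

/-- Translation by `0`. [folklore] -/
@[simp] theorem shE_zero (e : Sym2 (Site d)) : shE 0 e = e := by
  induction e using Sym2.ind with
  | h x y => simp

/-- `shE (-v)` undoes `shE v`. [folklore] -/
@[simp] theorem shE_neg_shE (e : Sym2 (Site d)) : shE (-v) (shE v e) = e := by
  rw [shE_shE, add_neg_cancel, shE_zero]

/-- `shE v` undoes `shE (-v)`. [folklore] -/
@[simp] theorem shE_shE_neg (e : Sym2 (Site d)) : shE v (shE (-v) e) = e := by
  rw [shE_shE, neg_add_cancel, shE_zero]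

/-- `shE v` is injective. [folklore] -/
theorem shE_injective : Function.Injective (shE (d := d) v) := fun e _ h => by
  rw [← shE_neg_shE v e, h, shE_neg_shE]

/-- Membership in a translated edge. [folklore] -/
theorem mem_shE {e : Sym2 (Site d)} {z : Site d} : z ∈ shE v e ↔ z - v ∈ e := by
  induction e using Sym2.ind with
  | h x y =>
    simp only [shE_mk, Sym2.mem_iff]
    constructor
    · rintro (rfl | rfl) <;> simp
    · rintro (h | h)
      · left; rw [← h]; abel
      · right; rw [← h]; abel

/-- Membership in a translated edge set. [folklore] -/
theorem mem_shiftE {F : Finset (Sym2 (Site d))} {e : Sym2 (Site d)} : e ∈ shiftE v F ↔ shE (-v) e ∈ F := by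
  rw [shiftE, mem_image]
  constructor
  · rintro ⟨e', he', rfl⟩; rwa [shE_neg_shE]
  · intro h; exact ⟨_, h, shE_shE_neg v e⟩

/-- Membership of a translated edge in a translated edge set. [folklore] -/
@[simp] theorem shE_mem_shiftE {F : Finset (Sym2 (Site d))} {e : Sym2 (Site d)} : shE v e ∈ shiftE v F ↔ e ∈ F := by
  rw [mem_shiftE, shE_neg_shE]

/-- Translations of edge sets compose. [folklore] -/
theorem shiftE_shiftE (u v : Site d) (F : Finset (Sym2 (Site d))) : shiftE u (shiftE v F) = shiftE (v + u) F := by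
  ext e; simp only [mem_shiftE, shE_shE]; rw [show -u + -v = -(v + u) by abel]

/-- Translation by `0`. [folklore] -/
@[simp] theorem shiftE_zero (F : Finset (Sym2 (Site d))) : shiftE 0 F = F := by
  ext e; simp [mem_shiftE]

/-- `shiftE v` is monotone. [folklore] -/
theorem shiftE_mono {F F' : Finset (Sym2 (Site d))} (h : F ⊆ F') : shiftE v F ⊆ shiftE v F' := image_subset_image h

/-- `shiftE v` reflects inclusions. [folklore] -/
theorem shiftE_subset_iff {F F' : Finset (Sym2 (Site d))} : shiftE v F ⊆ shiftE v F' ↔ F ⊆ F' :=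
  ⟨fun h _ he => (shE_mem_shiftE v).1 (h ((shE_mem_shiftE v).2 he)), shiftE_mono v⟩

/-- `shiftE v` commutes with intersections. [folklore] -/
theorem shiftE_inter (F F' : Finset (Sym2 (Site d))) : shiftE v (F ∩ F') = shiftE v F ∩ shiftE v F' := by
  ext e; simp only [mem_shiftE, mem_inter]

/-- `shiftE (-v)` undoes `shiftE v`. [folklore] -/
@[simp] theorem shiftE_neg_shiftE (F : Finset (Sym2 (Site d))) : shiftE (-v) (shiftE v F) = F := by
  rw [shiftE_shiftE, add_neg_cancel, shiftE_zero]

/-- `shiftE v` undoes `shiftE (-v)`. [folklore] -/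
@[simp] theorem shiftE_shiftE_neg (F : Finset (Sym2 (Site d))) : shiftE v (shiftE (-v) F) = F := by
  rw [shiftE_shiftE, neg_add_cancel, shiftE_zero]

/-- `shiftE v` is injective. [folklore] -/
theorem shiftE_injective : Function.Injective (shiftE (d := d) v) := fun F F' h => by
  rw [← shiftE_neg_shiftE v F, h, shiftE_neg_shiftE]

/-- The powerset of a translated edge set. [folklore] -/
theorem powerset_shiftE (F : Finset (Sym2 (Site d))) : (shiftE v F).powerset = F.powerset.image (shiftE v) := by
  ext ω
  rw [mem_powerset, mem_image]
  constructor
  · intro h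
    refine ⟨shiftE (-v) ω, mem_powerset.2 ((shiftE_subset_iff v).1 (by rwa [shiftE_shiftE_neg])), shiftE_shiftE_neg v ω⟩
  · rintro ⟨ω', hω', rfl⟩; exact shiftE_mono v (mem_powerset.1 hω')

/-- The cardinality of a translated edge set. [folklore] -/
@[simp] theorem card_shiftE (F : Finset (Sym2 (Site d))) : #(shiftE v F) = #F := card_image_of_injective _ (shE_injective v)

/-- Membership of a translated site in a translated set. [folklore] -/
@[simp] theorem add_mem_shiftSet {A : Finset (Site d)} {x : Site d} : x + v ∈ shiftSet v A ↔ x ∈ A := by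
  rw [mem_shiftSet, add_sub_cancel_right]

/-- Inclusion of translated sets. [folklore] -/
theorem shiftSet_subset_iff {A B : Finset (Site d)} : shiftSet v A ⊆ shiftSet v B ↔ A ⊆ B := Finset.map_subset_map

/-- The sup-distance is translation invariant. [folklore] -/
@[simp] theorem supDist_add (x y : Site d) : supDist (x + v) (y + v) = supDist x y := by
  simp [supDist]

/-- Lattice adjacency is translation invariant. [folklore] -/
@[simp] theorem zdGraph_adj_add {x y : Site d} : (zdGraph d).Adj (x + v) (y + v) ↔ (zdGraph d).Adj x y := by
  simp only [zdGraph_adj_iff, add_right_comm _ v, add_left_inj]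

/-- `★`-adjacency is translation invariant. [folklore] -/
@[simp] theorem zdStar_adj_add {x y : Site d} : (zdStar d).Adj (x + v) (y + v) ↔ (zdStar d).Adj x y := by
  rw [zdStar_adj, zdStar_adj, supDist_add]; simp

/-- Translated lattice edges are lattice edges. [folklore] -/
@[simp] theorem shE_mem_edgeSet {e : Sym2 (Site d)} : shE v e ∈ (zdGraph d).edgeSet ↔ e ∈ (zdGraph d).edgeSet := by
  induction e using Sym2.ind with
  | h x y => rw [shE_mk, SimpleGraph.mem_edgeSet, SimpleGraph.mem_edgeSet, zdGraph_adj_add]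

/-- The `★`-ball of a translated site. [folklore] -/
theorem starBall_add (x : Site d) : starBall (x + v) = shiftSet v (starBall x) := by
  ext y; rw [mem_shiftSet, mem_starBall, mem_starBall, ← supDist_add v x (y - v), sub_add_cancel]

/-- The radius-2 ball of a translated site. [folklore] -/
theorem starBall2_add (x : Site d) : starBall2 (x + v) = shiftSet v (starBall2 x) := by
  ext y; rw [mem_shiftSet, mem_starBall2, mem_starBall2, ← supDist_add v x (y - v), sub_add_cancel]

/-- The neighbours of a translated site. [folklore] -/
theorem nbrs_add (x : Site d) : nbrs (x + v) = shiftSet v (nbrs x) := by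
  ext y; rw [mem_shiftSet, mem_nbrs, mem_nbrs, ← zdGraph_adj_add v (x := x) (y := y - v), sub_add_cancel]

/-- The edges inside a translated set. [folklore] -/
theorem nnEdges_shift (A : Finset (Site d)) : nnEdges (shiftSet v A) = shiftE v (nnEdges A) := by
  ext e
  rw [mem_shiftE, mem_nnEdges, mem_nnEdges, shE_mem_edgeSet]
  refine and_congr_right fun _ => ⟨fun h z hz => ?_, fun h w hw => ?_⟩
  · have hz' : z + v ∈ e := by have := (mem_shE (-v)).1 hz; rwa [sub_neg_eq_add] at this
    exact (add_mem_shiftSet v).1 (h _ hz')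
  · rw [mem_shiftSet]
    exact h _ ((mem_shE (-v)).2 (by rw [sub_neg_eq_add, sub_add_cancel]; exact hw))

/-- The co-ball of a translated edge. [folklore] -/
theorem mem_coBall_shE {e : Sym2 (Site d)} {x : Site d} : x + v ∈ coBall (shE v e) ↔ x ∈ coBall e := by
  rw [mem_coBall_iff, mem_coBall_iff]
  constructor
  · intro h z hz
    have := h (z + v) ((mem_shE v).2 (by rwa [add_sub_cancel_right]))
    rwa [starBall_add, add_mem_shiftSet] at this
  · intro h z hz
    have := h (z - v) ((mem_shE v).1 hz)
    rw [starBall_add, mem_shiftSet]; exact this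

/-- The co-ball of an edge translated back. [folklore] -/
theorem mem_coBall_shE_neg {e : Sym2 (Site d)} {x : Site d} : x ∈ coBall (shE (-v) e) ↔ x + v ∈ coBall e := by
  have := mem_coBall_shE v (e := shE (-v) e) (x := x); rw [shE_shE_neg] at this; exact this.symm

/-- The ball edges of a translated site. [folklore] -/
theorem ballEdges_add (x : Site d) : ballEdges (x + v) = shiftE v (ballEdges x) := by
  ext e
  rw [mem_shiftE, mem_ballEdges_iff, mem_ballEdges_iff, shE_mem_edgeSet, mem_coBall_shE_neg]

/-- The core of a translated volume. [folklore] -/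
theorem core_shift (V : Finset (Site d)) : core (shiftSet v V) = shiftSet v (core V) := by
  ext x
  rw [mem_shiftSet, mem_core, mem_core]
  conv_lhs => rw [← sub_add_cancel x v, starBall2_add]
  exact shiftSet_subset_iff v

/-- The inner volume of a translated volume. [folklore] -/
theorem inner1_shift (V : Finset (Site d)) : inner1 (shiftSet v V) = shiftSet v (inner1 V) := by
  ext x
  rw [mem_shiftSet, mem_inner1, mem_inner1]
  conv_lhs => rw [← sub_add_cancel x v, starBall_add]
  exact shiftSet_subset_iff v

/-- The free edges of a translated volume. [folklore] -/
theorem freeEdges_shift (V : Finset (Site d)) : freeEdges (shiftSet v V) = shiftE v (freeEdges V) := by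
  ext e
  rw [mem_shiftE, mem_freeEdges, mem_freeEdges, shE_mem_edgeSet, core_shift]
  refine and_congr_right fun _ => ⟨fun h x hx => ?_, fun h y hy => ?_⟩
  · exact (add_mem_shiftSet v).1 (h ((mem_coBall_shE_neg v).1 hx))
  · rw [mem_shiftSet]
    exact h ((mem_coBall_shE_neg v).2 (by rw [sub_add_cancel]; exact hy))

/-- The exterior `★`-boundary of a translated set. [folklore] -/
theorem exBoundary_shift (A : Finset (Site d)) : exBoundary (shiftSet v A) = shiftSet v (exBoundary A) := by
  ext y
  rw [mem_shiftSet, mem_exBoundary, mem_exBoundary, mem_shiftSet]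
  refine and_congr_right fun _ => ⟨?_, ?_⟩
  · rintro ⟨x, hx, hxy⟩
    exact ⟨x - v, mem_shiftSet.1 hx, by rw [← zdStar_adj_add v, sub_add_cancel, sub_add_cancel]; exact hxy⟩
  · rintro ⟨x, hx, hxy⟩
    exact ⟨x + v, (add_mem_shiftSet v).2 hx, by rw [← sub_add_cancel y v, zdStar_adj_add]; exact hxy⟩

/-- The interior `★`-boundary of a translated set. [folklore] -/
theorem inBoundary_shift (A : Finset (Site d)) : inBoundary (shiftSet v A) = shiftSet v (inBoundary A) := by
  ext x
  rw [mem_shiftSet, mem_inBoundary, mem_inBoundary, mem_shiftSet]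
  refine and_congr_right fun _ => ⟨?_, ?_⟩
  · rintro ⟨y, hy, hxy⟩
    exact ⟨y - v, fun h => hy (by rw [← sub_add_cancel y v]; exact (add_mem_shiftSet v).2 h),
      by rw [← zdStar_adj_add v, sub_add_cancel, sub_add_cancel]; exact hxy⟩
  · rintro ⟨y, hy, hxy⟩
    exact ⟨y + v, fun h => hy ((add_mem_shiftSet v).1 h), by rw [← sub_add_cancel x v, zdStar_adj_add]; exact hxy⟩

/-! #### Chains and connectedness -/

/-- **`★`-chains translate**: for sets `T`, `T'` with `T' = T + v`, chains in `T'` from `x + v` to `y + v` are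
chains in `T` from `x` to `y`. [folklore] -/
theorem reflTransGen_starRel_shift {T T' : Set (Site d)} (hT : ∀ z, z + v ∈ T' ↔ z ∈ T) {x y : Site d}
    (h : ReflTransGen (starRel T) x y) : ReflTransGen (starRel T') (x + v) (y + v) := by
  induction h with
  | refl => exact ReflTransGen.refl
  | tail _ hbc ih => exact ih.tail ⟨(zdStar_adj_add v).2 hbc.1, (hT _).2 hbc.2.1, (hT _).2 hbc.2.2⟩

/-- `★`-chains translate (iff form). [folklore] -/
theorem reflTransGen_starRel_shift_iff {T T' : Set (Site d)} (hT : ∀ z, z + v ∈ T' ↔ z ∈ T) {x y : Site d} :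
    ReflTransGen (starRel T') (x + v) (y + v) ↔ ReflTransGen (starRel T) x y := by
  refine ⟨fun h => ?_, reflTransGen_starRel_shift v hT⟩
  have hT' : ∀ z, z + -v ∈ T ↔ z ∈ T' := fun z => by rw [← hT, neg_add_cancel_right]
  have := reflTransGen_starRel_shift (-v) hT' h
  rwa [add_neg_cancel_right, add_neg_cancel_right] at this

/-- The translated set as a set. [folklore] -/
theorem coe_shiftSet_iff (A : Finset (Site d)) : ∀ z, z + v ∈ ((shiftSet v A : Finset (Site d)) : Set (Site d)) ↔ z ∈ (A : Set (Site d)) :=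
  fun z => by rw [mem_coe, mem_coe, add_mem_shiftSet]

/-- The complement of the translated set. [folklore] -/
theorem compl_shiftSet_iff (A : Finset (Site d)) :
    ∀ z, z + v ∈ ((shiftSet v A : Finset (Site d)) : Set (Site d))ᶜ ↔ z ∈ (A : Set (Site d))ᶜ :=
  fun z => by rw [Set.mem_compl_iff, Set.mem_compl_iff, mem_coe, mem_coe, add_mem_shiftSet]

/-- `★`-connectedness is translation invariant. [folklore] -/
theorem starConn_shift_iff (A : Finset (Site d)) : StarConn ((shiftSet v A : Finset (Site d)) : Set (Site d)) ↔ StarConn (A : Set (Site d)) := by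
  constructor
  · intro h x hx y hy
    have := h (x + v) ((coe_shiftSet_iff v A x).2 hx) (y + v) ((coe_shiftSet_iff v A y).2 hy)
    exact (reflTransGen_starRel_shift_iff v (coe_shiftSet_iff v A)).1 this
  · intro h x hx y hy
    have hx' : x - v ∈ (A : Set (Site d)) := (coe_shiftSet_iff v A _).1 (by rw [sub_add_cancel]; exact hx)
    have hy' : y - v ∈ (A : Set (Site d)) := (coe_shiftSet_iff v A _).1 (by rw [sub_add_cancel]; exact hy)
    have := reflTransGen_starRel_shift v (coe_shiftSet_iff v A) (h _ hx' _ hy')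
    rwa [sub_add_cancel, sub_add_cancel] at this

/-! #### The exterior, the hull, interior components -/

/-- A bound on the coordinates of `v`. [folklore] -/
def crd (v : Site d) : ℕ := univ.sup fun i => (v i).natAbs

/-- Each coordinate of `v` is bounded by `crd v`. [folklore] -/
theorem natAbs_le_crd (i : Fin d) : (v i).natAbs ≤ crd v := le_sup (f := fun i => (v i).natAbs) (mem_univ i)

/-- A translated set lies in an enlarged box. [folklore] -/
theorem shiftSet_subset_box {S : Finset (Site d)} {R : ℕ} (hS : S ⊆ box d R) : shiftSet v S ⊆ box d (R + crd v) := by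
  intro z hz
  have hz' := mem_box.1 (hS (mem_shiftSet.1 hz))
  rw [mem_box]
  intro i
  have h1 := hz' i; have h2 := natAbs_le_crd v i
  simp only [Pi.sub_apply] at h1
  constructor <;> omega

/-- Translating a far point keeps it far (with a margin). [folklore] -/
theorem add_mem_farSet {R : ℕ} {y : Site d} (hy : y ∈ farSet d (R + 2 * crd v)) : y + v ∈ farSet d (R + crd v) := by
  obtain ⟨i, hi⟩ := hy
  refine ⟨i, ?_⟩
  have h2 := natAbs_le_crd v i
  simp only [Pi.add_apply]
  omega

/-- **The exterior is translation invariant.** [cite: FriedliVelenik2017, §7.2.6] -/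
theorem add_mem_starExt_iff (hd : 2 ≤ d) (S : Finset (Site d)) (x : Site d) : x + v ∈ starExt (shiftSet v S) ↔ x ∈ starExt S := by
  have key : ∀ (w : Site d) (T : Finset (Site d)) (z : Site d), z ∈ starExt T → z + w ∈ starExt (shiftSet w T) := by
    intro w T z hz
    obtain ⟨hzT, y, hy, hzy⟩ := (mem_starExt_iff hd (subset_box_boxRadius T)).1 hz
    obtain ⟨y', hy', hyy'⟩ := exists_far_reflTransGen hd (subset_box_boxRadius T) (boxRadius T + 2 * crd w) hy
    refine (mem_starExt_iff hd (shiftSet_subset_box w (subset_box_boxRadius T))).2 ⟨fun h => hzT ((add_mem_shiftSet w).1 h), y' + w,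
      add_mem_farSet w hy', reflTransGen_starRel_shift w (compl_shiftSet_iff w T) (hzy.trans hyy')⟩
  refine ⟨fun h => ?_, key v S x⟩
  have := key (-v) (shiftSet v S) (x + v) h
  rwa [add_neg_cancel_right, IsSmallTIActivity.shiftSet_shiftSet, add_neg_cancel, IsSmallTIActivity.shiftSet_zero] at this

/-- **The hull is translation invariant.** [cite: FriedliVelenik2017, §7.2.6] -/
theorem starHullFinset_shift (hd : 2 ≤ d) (S : Finset (Site d)) : starHullFinset (shiftSet v S) = shiftSet v (starHullFinset S) := by
  ext x
  rw [mem_shiftSet, mem_starHullFinset hd, mem_starHullFinset hd, starHull, starHull, Set.mem_compl_iff, Set.mem_compl_iff,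
    ← add_mem_starExt_iff v hd S (x - v), sub_add_cancel]

/-- The interior is translation invariant. [cite: FriedliVelenik2017, §7.2.6] -/
theorem starInt_shift (hd : 2 ≤ d) (S : Finset (Site d)) : starInt (shiftSet v S) = shiftSet v (starInt S) := by
  ext x; rw [starInt, starInt, mem_shiftSet, mem_sdiff, mem_sdiff, starHullFinset_shift v hd, mem_shiftSet, mem_shiftSet]

/-- **Interior components are translation invariant.** [cite: FriedliVelenik2017, §7.2.6, eq. (7.22)] -/
theorem starIntComp_shift (hd : 2 ≤ d) (S : Finset (Site d)) (x : Site d) :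
    starIntComp (shiftSet v S) (x + v) = shiftSet v (starIntComp S x) := by
  classical
  ext y
  rw [mem_shiftSet, starIntComp, starIntComp, mem_filter, mem_filter, starInt_shift v hd, mem_shiftSet,
    ← reflTransGen_starRel_shift_iff v (compl_shiftSet_iff v S) (x := x) (y := y - v), sub_add_cancel]

end Geometry

/-! ### 2. Class counts under an injective relabelling -/

section ClassMap

variable {α β : Type*} [DecidableEq α] [DecidableEq β] {R : α → α → Prop} {R' : β → β → Prop} {U : Finset α}
  (φ : α → β) (hφ : Function.Injective φ) (hR : ∀ a b, R' (φ a) (φ b) ↔ R a b)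
include hφ hR

omit [DecidableEq α] in
/-- Chains inside the image come from chains inside the set. [folklore] -/
theorem reflTransGen_relIn_image_iff {a : α} {b' : β} :
    ReflTransGen (relIn R' (U.image φ)) (φ a) b' ↔ ∃ b, b' = φ b ∧ ReflTransGen (relIn R U) a b := by
  constructor
  · intro h
    induction h with
    | refl => exact ⟨a, rfl, ReflTransGen.refl⟩
    | tail _ hbc ih =>
      obtain ⟨b, rfl, hab⟩ := ih
      obtain ⟨c, hcU, hc⟩ := mem_image.1 hbc.2.2
      subst hc
      obtain ⟨b₀, hb₀U, hbb₀⟩ := mem_image.1 hbc.2.1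
      obtain rfl := hφ hbb₀
      exact ⟨c, rfl, hab.tail ⟨(hR _ _).1 hbc.1, hb₀U, hcU⟩⟩
  · rintro ⟨b, rfl, h⟩
    induction h with
    | refl => exact ReflTransGen.refl
    | tail _ hbc ih => exact ih.tail ⟨(hR _ _).2 hbc.1, mem_image_of_mem _ hbc.2.1, mem_image_of_mem _ hbc.2.2⟩

omit [DecidableEq α] in
/-- Classes of the image are images of classes. [folklore] -/
theorem cls_image (x : α) : cls R' (U.image φ) (φ x) = (cls R U x).image φ := by
  ext y'
  constructor
  · intro hy'
    obtain ⟨hy'U, h⟩ := mem_cls.1 hy'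
    obtain ⟨y, rfl, hxy⟩ := (reflTransGen_relIn_image_iff φ hφ hR).1 h
    obtain ⟨y₀, hy₀, hyy₀⟩ := mem_image.1 hy'U
    obtain rfl := hφ hyy₀
    exact mem_image_of_mem _ (mem_cls.2 ⟨hy₀, hxy⟩)
  · intro hy'
    obtain ⟨y, hy, rfl⟩ := mem_image.1 hy'
    obtain ⟨hyU, hxy⟩ := mem_cls.1 hy
    exact mem_cls.2 ⟨mem_image_of_mem _ hyU, (reflTransGen_relIn_image_iff φ hφ hR).2 ⟨y, rfl, hxy⟩⟩

/-- **The number of classes is invariant under an injective relabelling respecting the relation.** [folklore] -/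
theorem ccount_image : ccount R' (U.image φ) = ccount R U := by
  rw [ccount, ccount, image_image]
  have : (U.image (cls R' (U.image φ) ∘ φ)) = (U.image (cls R U)).image (Finset.image φ) := by
    rw [image_image]
    exact image_congr fun x _ => by simp only [Function.comp_apply, cls_image φ hφ hR]
  rw [this, card_image_of_injective _ (image_injective hφ)]

end ClassMap

/-! ### 3. Configurations, contours and their translates -/

section Config

variable (v : Site d) {σ : Phase} {F ω : Finset (Sym2 (Site d))}

/-- `shiftSet` as an image. [folklore] -/
theorem shiftSet_eq_image (A : Finset (Site d)) : shiftSet v A = A.image (· + v) := by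
  rw [shiftSet_eq_map, map_eq_image]; rfl

/-- Quantifying over a translated edge set. [folklore] -/
theorem forall_mem_shiftE {A : Finset (Sym2 (Site d))} {P : Sym2 (Site d) → Prop} : (∀ e ∈ shiftE v A, P e) ↔ ∀ e ∈ A, P (shE v e) := by
  unfold shiftE; exact forall_mem_image

/-- Openness is translation invariant. [folklore] -/
@[simp] theorem eOpen_shift {e : Sym2 (Site d)} : EOpen σ (shiftE v F) (shiftE v ω) (shE v e) ↔ EOpen σ F ω e := by
  simp only [EOpen, shE_mem_shiftE]

/-- `ord`-goodness is translation invariant. [folklore] -/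
@[simp] theorem ordGood_shift {x : Site d} : OrdGood σ (shiftE v F) (shiftE v ω) (x + v) ↔ OrdGood σ F ω x := by
  simp only [OrdGood, ballEdges_add, forall_mem_shiftE, eOpen_shift]

/-- `dis`-goodness is translation invariant. [folklore] -/
@[simp] theorem disGood_shift {x : Site d} : DisGood σ (shiftE v F) (shiftE v ω) (x + v) ↔ DisGood σ F ω x := by
  simp only [DisGood, ballEdges_add, forall_mem_shiftE, eOpen_shift]

/-- Badness is translation invariant. [folklore] -/
@[simp] theorem bad_shift {x : Site d} : Bad σ (shiftE v F) (shiftE v ω) (x + v) ↔ Bad σ F ω x := by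
  rw [Bad, Bad, ordGood_shift, disGood_shift]

/-- Open adjacency is translation invariant. [folklore] -/
@[simp] theorem rOpen_shift {a b : Site d} : ROpen σ (shiftE v F) (shiftE v ω) (a + v) (b + v) ↔ ROpen σ F ω a b := by
  rw [ROpen, ROpen, zdGraph_adj_add, ← shE_mk, eOpen_shift]

/-- The open degree is translation invariant. [folklore] -/
theorem oDeg_config_shift (x : Site d) : oDeg σ (shiftE v F) (shiftE v ω) (x + v) = oDeg σ F ω x := by
  rw [oDeg, oDeg, nbrs_add, shiftSet_eq_image, filter_image, card_image_of_injective _ (add_left_injective v)]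
  congr 1
  exact filter_congr fun y _ => by rw [← shE_mk, eOpen_shift]

/-- **The thick bad set of a translated configuration.** [cite: FriedliVelenik2017, §7.4.2 (translation invariance)] -/
theorem thick_shift (hω : ω ⊆ F) : thick σ (shiftE v F) (shiftE v ω) = shiftSet v (thick σ F ω) := by
  ext y
  rw [mem_shiftSet, mem_thick (shiftE_mono v hω), mem_thick hω]
  constructor
  · rintro ⟨b, hb, hyb⟩
    refine ⟨b - v, (bad_shift v).1 (by rw [sub_add_cancel]; exact hb), ?_⟩
    rw [← add_mem_shiftSet v, ← starBall_add, sub_add_cancel, sub_add_cancel]; exact hyb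
  · rintro ⟨b, hb, hyb⟩
    refine ⟨b + v, (bad_shift v).2 hb, ?_⟩
    rw [starBall_add, mem_shiftSet]; exact hyb

/-- The component of the thick bad set through a translated point. [folklore] -/
theorem suppAt_shift (hω : ω ⊆ F) {z : Site d} (hz : z ∈ thick σ F ω) :
    suppAt σ (shiftE v F) (shiftE v ω) (z + v) = shiftSet v (suppAt σ F ω z) := by
  have hz' : z + v ∈ thick σ (shiftE v F) (shiftE v ω) := by rw [thick_shift v hω, add_mem_shiftSet]; exact hz
  ext y
  rw [mem_shiftSet, mem_suppAt hz', mem_suppAt hz, thick_shift v hω,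
    ← reflTransGen_starRel_shift_iff v (coe_shiftSet_iff v (thick σ F ω)) (x := z) (y := y - v), sub_add_cancel]

/-- **The supports of a translated configuration.** [cite: FriedliVelenik2017, §7.4.2] -/
theorem supports_shift (hω : ω ⊆ F) : supports σ (shiftE v F) (shiftE v ω) = (supports σ F ω).image (shiftSet v) := by
  ext S
  rw [mem_supports, mem_image]
  constructor
  · rintro ⟨z, hz, rfl⟩
    have hz0 : z - v ∈ thick σ F ω := by rw [thick_shift v hω, mem_shiftSet] at hz; exact hz
    refine ⟨suppAt σ F ω (z - v), mem_supports.2 ⟨z - v, hz0, rfl⟩, ?_⟩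
    rw [← suppAt_shift v hω hz0, sub_add_cancel]
  · rintro ⟨S₀, hS₀, rfl⟩
    obtain ⟨z, hz, rfl⟩ := mem_supports.1 hS₀
    exact ⟨z + v, by rw [thick_shift v hω, add_mem_shiftSet]; exact hz, suppAt_shift v hω hz⟩

/-- **The translate of a contour.** [cite: FriedliVelenik2017, §7.4.2 (translates of contours)] -/
def Contour.shift (v : Site d) (c : Contour d) : Contour d := ⟨shiftSet v c.supp, shiftE v c.openE, shiftSet v c.ordB⟩

/-- The support of the translate. [folklore] -/
@[simp] theorem Contour.shift_supp (c : Contour d) : (c.shift v).supp = shiftSet v c.supp := rfl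

/-- The open edges of the translate. [folklore] -/
@[simp] theorem Contour.shift_openE (c : Contour d) : (c.shift v).openE = shiftE v c.openE := rfl

/-- The `ord` boundary sites of the translate. [folklore] -/
@[simp] theorem Contour.shift_ordB (c : Contour d) : (c.shift v).ordB = shiftSet v c.ordB := rfl

/-- **Extracting contours commutes with translation.** [cite: FriedliVelenik2017, §7.4.2] -/
theorem contourAt_shift (S : Finset (Site d)) : contourAt σ (shiftE v F) (shiftE v ω) (shiftSet v S) = (contourAt σ F ω S).shift v := by
  refine Contour.ext' rfl ?_ ?_
  · ext e
    change e ∈ (nnEdges (shiftSet v S)).filter (fun e => EOpen σ (shiftE v F) (shiftE v ω) e) ↔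
      e ∈ shiftE v ((nnEdges S).filter fun e => EOpen σ F ω e)
    rw [mem_filter, mem_shiftE, mem_filter, nnEdges_shift, mem_shiftE, ← eOpen_shift v (e := shE (-v) e), shE_shE_neg]
  · ext y
    change y ∈ (exBoundary (shiftSet v S)).filter (fun y => OrdGood σ (shiftE v F) (shiftE v ω) y) ↔
      y ∈ shiftSet v ((exBoundary S).filter fun y => OrdGood σ F ω y)
    rw [mem_filter, mem_shiftSet, mem_filter, exBoundary_shift, mem_shiftSet, ← ordGood_shift v (x := y - v), sub_add_cancel]

/-- **Translates of well-formed contours are well-formed.** [cite: FriedliVelenik2017, §7.4.2 (𝒞^# translation invariant)] -/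
theorem WF.shift {c : Contour d} (h : WF c) : WF (c.shift v) := by
  obtain ⟨σ, F, ω, hω, hc⟩ := h
  obtain ⟨S, hS, rfl⟩ := mem_contoursOf.1 hc
  refine ⟨σ, shiftE v F, shiftE v ω, shiftE_mono v hω, mem_contoursOf.2 ⟨shiftSet v S, ?_, contourAt_shift v (σ := σ) (F := F) (ω := ω) S⟩⟩
  rw [supports_shift v hω]; exact mem_image_of_mem _ hS

/-! #### Intrinsic quantities of translated contours -/

variable (c : Contour d)

/-- Translation by `0`. [folklore] -/
theorem Contour.shift_zero : c.shift 0 = c :=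
  Contour.ext' (IsSmallTIActivity.shiftSet_zero _) (shiftE_zero _) (IsSmallTIActivity.shiftSet_zero _)

/-- Translations compose. [folklore] -/
theorem Contour.shift_add (u v : Site d) : c.shift (u + v) = (c.shift v).shift u :=
  Contour.ext' (by rw [Contour.shift_supp, Contour.shift_supp, Contour.shift_supp, IsSmallTIActivity.shiftSet_shiftSet, add_comm])
    (by rw [Contour.shift_openE, Contour.shift_openE, Contour.shift_openE, shiftE_shiftE, add_comm])
    (by rw [Contour.shift_ordB, Contour.shift_ordB, Contour.shift_ordB, IsSmallTIActivity.shiftSet_shiftSet, add_comm])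

/-- `CompOrd` is translation invariant. [folklore] -/
theorem compOrd_shift {u : Site d} : (c.shift v).CompOrd (u + v) ↔ c.CompOrd u := by
  rw [Contour.CompOrd, Contour.CompOrd, Contour.shift_ordB, Contour.shift_supp]
  constructor
  · rintro ⟨y, hy, huy⟩
    refine ⟨y - v, mem_shiftSet.1 hy, ?_⟩
    rw [← reflTransGen_starRel_shift_iff v (compl_shiftSet_iff v c.supp), sub_add_cancel]; exact huy
  · rintro ⟨y, hy, huy⟩
    exact ⟨y + v, (add_mem_shiftSet v).2 hy, reflTransGen_starRel_shift v (compl_shiftSet_iff v c.supp) huy⟩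

/-- Intrinsic openness is translation invariant. [folklore] -/
@[simp] theorem isOpen_shift {e : Sym2 (Site d)} : (c.shift v).IsOpen (shE v e) ↔ c.IsOpen e := by
  rw [Contour.IsOpen, Contour.IsOpen, Contour.shift_openE, Contour.shift_supp, shE_mem_shiftE, nnEdges_shift, shE_mem_shiftE]
  refine or_congr_right (and_congr_right fun _ => ⟨?_, ?_⟩)
  · rintro ⟨u, hu, huS, hc⟩
    refine ⟨u - v, (mem_shE v).1 hu, fun h => huS (by rw [← sub_add_cancel u v]; exact (add_mem_shiftSet v).2 h), ?_⟩
    rw [← compOrd_shift v c, sub_add_cancel]; exact hc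
  · rintro ⟨u, hu, huS, hc⟩
    exact ⟨u + v, (mem_shE v).2 (by rw [add_sub_cancel_right]; exact hu), fun h => huS ((add_mem_shiftSet v).1 h), (compOrd_shift v c).2 hc⟩

/-- Labels are translation invariant. [folklore] -/
theorem lab_shift (A : Finset (Site d)) : (c.shift v).lab (shiftSet v A) = c.lab A := by
  have h : (∃ y ∈ (c.shift v).ordB, y ∈ shiftSet v A) ↔ ∃ y ∈ c.ordB, y ∈ A := by
    rw [Contour.shift_ordB]
    constructor
    · rintro ⟨y, hy, hyA⟩; exact ⟨y - v, mem_shiftSet.1 hy, mem_shiftSet.1 hyA⟩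
    · rintro ⟨y, hy, hyA⟩; exact ⟨y + v, (add_mem_shiftSet v).2 hy, (add_mem_shiftSet v).2 hyA⟩
  unfold Contour.lab
  by_cases hc : ∃ y ∈ c.ordB, y ∈ A
  · rw [if_pos hc, if_pos (h.2 hc)]
  · rw [if_neg hc, if_neg (fun h' => hc (h.1 h'))]

/-- The type is translation invariant. [cite: FriedliVelenik2017, §7.4.2] -/
theorem type_shift (hd : 2 ≤ d) : (c.shift v).type = c.type := by
  have h : (∃ y ∈ (c.shift v).ordB, y ∈ starExt (c.shift v).supp) ↔ ∃ y ∈ c.ordB, y ∈ starExt c.supp := by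
    rw [Contour.shift_ordB, Contour.shift_supp]
    constructor
    · rintro ⟨y, hy, hye⟩
      exact ⟨y - v, mem_shiftSet.1 hy, (add_mem_starExt_iff v hd c.supp _).1 (by rw [sub_add_cancel]; exact hye)⟩
    · rintro ⟨y, hy, hye⟩; exact ⟨y + v, (add_mem_shiftSet v).2 hy, (add_mem_starExt_iff v hd c.supp _).2 hye⟩
  unfold Contour.type
  by_cases hc : ∃ y ∈ c.ordB, y ∈ starExt c.supp
  · rw [if_pos hc, if_pos (h.2 hc)]
  · rw [if_neg hc, if_neg (fun h' => hc (h.1 h'))]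

/-- Intrinsic `ord`-goodness is translation invariant. [folklore] -/
theorem iOrdGood_shift {x : Site d} : (c.shift v).IOrdGood (x + v) ↔ c.IOrdGood x := by
  simp only [Contour.IOrdGood, ballEdges_add, forall_mem_shiftE, isOpen_shift]

/-- Intrinsic `dis`-goodness is translation invariant. [folklore] -/
theorem iDisGood_shift {x : Site d} : (c.shift v).IDisGood (x + v) ↔ c.IDisGood x := by
  simp only [Contour.IDisGood, ballEdges_add, forall_mem_shiftE, isOpen_shift]

/-- Intrinsic badness is translation invariant. [folklore] -/
theorem iBad_shift {x : Site d} : (c.shift v).IBad (x + v) ↔ c.IBad x := by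
  rw [Contour.IBad, Contour.IBad, iOrdGood_shift, iDisGood_shift]

/-- The intrinsic open degree is translation invariant. [folklore] -/
theorem oDeg_shift (x : Site d) : (c.shift v).oDeg (x + v) = c.oDeg x := by
  classical
  rw [Contour.oDeg, Contour.oDeg, nbrs_add, shiftSet_eq_image, filter_image, card_image_of_injective _ (add_left_injective v)]
  congr 1
  exact filter_congr fun y _ => by rw [← shE_mk, isOpen_shift]

/-- **The energy of a contour is translation invariant.** [cite: FriedliVelenik2017, §7.4.2] -/
theorem energy_shift : (c.shift v).energy = c.energy := by
  rw [Contour.energy, Contour.energy, Contour.shift_supp, shiftSet_eq_image, sum_image fun _ _ _ _ h => add_left_injective v h]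
  exact sum_congr rfl fun x _ => oDeg_shift v c x

/-- Interior components of the translate. [folklore] -/
theorem intComps_shift (hd : 2 ≤ d) : (c.shift v).intComps = c.intComps.image (shiftSet v) := by
  rw [Contour.intComps, Contour.intComps, Contour.shift_supp, starInt_shift v hd, image_image,
    shiftSet_eq_image v (starInt c.supp), image_image]
  exact image_congr fun x _ => by simp only [Function.comp_apply, starIntComp_shift v hd]

/-- `ord`-labelled interior components of the translate. [folklore] -/
theorem ordInts_shift (hd : 2 ≤ d) : (c.shift v).ordInts = c.ordInts.image (shiftSet v) := by
  rw [Contour.ordInts, Contour.ordInts, intComps_shift v c hd, filter_image]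
  congr 1
  exact filter_congr fun A _ => by rw [lab_shift]

/-- The exterior block of the translate. [folklore] -/
theorem opart_shift (hd : 2 ≤ d) : (c.shift v).Opart = shiftSet v c.Opart := by
  rw [Contour.Opart, Contour.Opart, type_shift v c hd, Contour.shift_supp, starHullFinset_shift v hd, exBoundary_shift]
  split_ifs
  · rfl
  · rw [shiftSet_eq_image, image_empty]

/-- The glued set of the translate. [folklore] -/
theorem ugl_shift (hd : 2 ≤ d) : (c.shift v).Ugl = shiftSet v c.Ugl := by
  rw [Contour.Ugl, Contour.Ugl, opart_shift v c hd, ordInts_shift v c hd, Contour.shift_supp, image_biUnion]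
  simp only [shiftSet_eq_image, image_union, biUnion_image]
  refine congrArg₂ (· ∪ ·) rfl (biUnion_congr rfl fun A _ => ?_)
  rw [← shiftSet_eq_image, ← shiftSet_eq_image, inBoundary_shift]

/-- The wired intrinsic relation of the translate. [folklore] -/
theorem rsharp_shift (hd : 2 ≤ d) {a b : Site d} : (c.shift v).Rsharp (a + v) (b + v) ↔ c.Rsharp a b := by
  rw [Contour.Rsharp, Contour.Rsharp, Contour.ROpen, Contour.ROpen, zdGraph_adj_add, ← shE_mk, isOpen_shift, opart_shift v c hd,
    add_mem_shiftSet, add_mem_shiftSet, ordInts_shift v c hd]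
  refine or_congr_right (or_congr_right ⟨?_, ?_⟩)
  · rintro ⟨A', hA', ha, hb⟩
    obtain ⟨A, hA, rfl⟩ := mem_image.1 hA'
    rw [inBoundary_shift, add_mem_shiftSet] at ha hb
    exact ⟨A, hA, ha, hb⟩
  · rintro ⟨A, hA, ha, hb⟩
    exact ⟨shiftSet v A, mem_image_of_mem _ hA, by rw [inBoundary_shift, add_mem_shiftSet]; exact ha,
      by rw [inBoundary_shift, add_mem_shiftSet]; exact hb⟩

/-- **The cluster exponent of a contour is translation invariant.** [cite: FriedliVelenik2017, §7.4.2] -/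
theorem cwt_shift (hd : 2 ≤ d) : (c.shift v).cwt = c.cwt := by
  rw [Contour.cwt, Contour.cwt, type_shift v c hd, Contour.ccl, Contour.ccl, ugl_shift v c hd, shiftSet_eq_image,
    ccount_image (· + v) (add_left_injective v) fun a b => rsharp_shift v c hd]

end Config

/-! ### 4. Volumes and partition functions; the translation action on random-cluster contours -/

section Volume

variable (v : Site d)

/-- **The energy of a translated configuration in the translated volume.** [cite: FriedliVelenik2017, §7.4.2] -/
theorem energyV_shift (σ : Phase) (V : Finset (Site d)) (ω : Finset (Sym2 (Site d))) :
    energy σ (shiftE v (freeEdges V)) (shiftE v ω) (shiftSet v V) = energy σ (freeEdges V) ω V := by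
  rw [energy, energy, shiftSet_eq_image, sum_image fun _ _ _ _ h => add_left_injective v h]
  exact sum_congr rfl fun x _ => oDeg_config_shift v x

/-- The boundary layer of a translated volume. [folklore] -/
theorem sdiff_inner1_shift (V : Finset (Site d)) : shiftSet v V \ inner1 (shiftSet v V) = shiftSet v (V \ inner1 V) := by
  rw [inner1_shift, shiftSet_eq_image, shiftSet_eq_image, shiftSet_eq_image, image_sdiff _ _ (add_left_injective v)]

/-- **The cluster functional of a translated configuration in the translated volume.** [cite: FriedliVelenik2017, §7.4.2] -/
theorem kappaV_shift (σ : Phase) (V : Finset (Site d)) (ω : Finset (Sym2 (Site d))) :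
    kappa σ (shiftSet v V) (shiftE v (freeEdges V)) (shiftE v ω) = kappa σ V (freeEdges V) ω := by
  cases σ
  · change ccount (wire (ROpen Phase.ord (shiftE v (freeEdges V)) (shiftE v ω)) (shiftSet v V \ inner1 (shiftSet v V))) (shiftSet v V) - 1 =
      ccount (wire (ROpen Phase.ord (freeEdges V) ω) (V \ inner1 V)) V - 1
    rw [sdiff_inner1_shift, shiftSet_eq_image v V,
      ccount_image (R := wire (ROpen Phase.ord (freeEdges V) ω) (V \ inner1 V)) (· + v) (add_left_injective v) fun a b => by
        rw [wire, wire, rOpen_shift, add_mem_shiftSet, add_mem_shiftSet]]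
  · change ccount (ROpen Phase.dis (shiftE v (freeEdges V)) (shiftE v ω)) (shiftSet v V) = ccount (ROpen Phase.dis (freeEdges V) ω) V
    rw [shiftSet_eq_image, ccount_image (R := ROpen Phase.dis (freeEdges V) ω) (· + v) (add_left_injective v) fun a b => rOpen_shift v]

/-- **The random-cluster partition function of a volume is translation invariant.** [cite: FriedliVelenik2017, §7.4.2; Grimmett2006, §4.3] -/
theorem Zrc_shift (t q : ℝ) (σ : Phase) (V : Finset (Site d)) : Zrc t q σ (shiftSet v V) = Zrc t q σ V := by
  rw [Zrc, Zrc, freeEdges_shift, powerset_shiftE, sum_image fun _ _ _ _ h => shiftE_injective v h]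
  exact sum_congr rfl fun ω _ => by rw [energyV_shift, kappaV_shift]

end Volume

/-- **The translation action on the well-formed random-cluster contours** (`d ≥ 2`).
[cite: FriedliVelenik2017, §7.4.2 (translation invariance of 𝒞^# and of the weights)] -/
def rcShift (hd : 2 ≤ d) : (rcSetup d).Shift where
  shift v γ := ⟨γ.1.shift v, WF.shift v γ.2⟩
  supp_shift _ _ := rfl
  type_shift v γ := type_shift v γ.1 hd
  shift_zero γ := Subtype.ext (Contour.shift_zero γ.1)
  shift_add u v γ := Subtype.ext (Contour.shift_add γ.1 u v)

section RcShift

variable (hd : 2 ≤ d) (v : Site d) (γ : (rcSetup d).Γ)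

/-- The underlying contour of the translate. [folklore] -/
theorem rcShift_val : ((rcShift hd).shift v γ).1 = γ.1.shift v := rfl

/-- The interior components of the translate. [folklore] -/
theorem ints_rcShift : (rcSetup d).ints ((rcShift hd).shift v γ) = ((rcSetup d).ints γ).image (shiftSet v) := intComps_shift v γ.1 hd

/-- The labels of the translate. [folklore] -/
theorem lab_rcShift (A : Finset (Site d)) : (rcSetup d).lab ((rcShift hd).shift v γ) (shiftSet v A) = (rcSetup d).lab γ A := lab_shift v γ.1 A

/-- The energy of the translate. [folklore] -/
theorem energy_rcShift : ((rcShift hd).shift v γ).1.energy = γ.1.energy := energy_shift v γ.1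

/-- The cluster exponent of the translate. [folklore] -/
theorem cwt_rcShift : ((rcShift hd).shift v γ).1.cwt = γ.1.cwt := cwt_shift v γ.1 hd

/-- The intrinsic type of the translate. [folklore] -/
theorem type_rcShift : ((rcShift hd).shift v γ).1.type = γ.1.type := type_shift v γ.1 hd

end RcShift

end RCC

end Literature.Probability.LatticeModels
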